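import Summits.Ventures.CertifiedManyBodySolver.Observables.DoccHoppingURayTTPrime
import Summits.Ventures.CertifiedManyBodySolver.Observables.StiffnessTLKineticTTOrbitDictionary
import Literature.MathematicalPhysics.QuantumLattice.HubbardTTPrimeBoxTransport
import HarnessLib

/-!
# Ventures/CertifiedManyBodySolver — Observables/StiffnessTTPrimeURay.lean

HONEST FRAMING: one-sided certified CEILINGS on the uniform flux stiffness at `t′ ≠ 0`, transported along a fixed-`t′` ray in `U` with an EXPLICIT
kinematic allowance for the diagonal hopping; a ceiling never speaks to presence or to `ρ_s = 0`; at the «La214-E» Mott box the allowance makes the ray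
words CONTENT-FREE versus the premise-free bar (said below in numbers); not a superconductivity or `T_c` verdict; no phase sentence.

Cell `hubbard-obs` (D-0042), seat p2 (stiffness), `prover-hubbard-obs-p2-g16-0`; pen commission (d1′) of RULING (yy) d295 (yy3): «type the `t′ ≠ 0` ray
edition (Hellmann–Feynman monotonicity of `−T_total` in `U` plus a diagonal allowance)». No definition, no claim node, no `sorry`.

THE POINT. At `t′ = 0` a kinetic ceiling at `(U₀, n, 0)` is a stiffness ceiling on the whole half-line `U ≥ U₀`
(`ObsStiffnessSeqCeilingAt_tp0_on_ray_of_forall_negKinetic_le`), because the f-sum functional IS `−¼·`(total kinetic energy) and `⟨−T⟩` is non-increasing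
in `U` (hubbard-fast T-mono). At `t′ ≠ 0` the f-sum functional is `F(ω) = −¼ e_{Φ(1,2t′,0)}(ω) = −¼ e_{Φ(1,t′,0)}(ω) − ¼ e_{Φ(0,t′,0)}(ω)`
(`orbitMean_rotOddMomentLimitFunctionalTT_lam_zero_eq_meanEnergy_twice_tPrime`; `meanEnergy_hubbardTTPrime_add`): the TOTAL hopping `e_{Φ(1,t′,0)}` still
transports (`forall_torusLimit_negHoppingTT'_le_of_le_coupling`, p546208), the extra diagonal term does NOT, and is only bounded kinematically:
`e_{Φ(0,t′,0)}(ω) ≥ e(0, t′, 0, n) ≥ −min(4n, 16/π²)·|t′|` (`IsTorusLimitOf.energyDensityTT'_le_meanEnergy_hubbardTTPrime`, `energyDensityTT'_diag_ge_min`).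

* `ObsStiffnessSeqCeilingAt_on_ray_of_forall_negHoppingTT'_le` — **a certified ceiling `X` on the total hopping `−(k + Σ_s Re ω(Φ^{diag}_{t′}))` over the
  record class at `(U₀, n, t′)` gives `ObsStiffnessSeqCeilingAt t′ U n c` for EVERY `U ≥ U₀` and every `c ≥ X/4 + |t′|·min(4n, 16/π²)/4`**;
  `…_decimal`: `c ≥ X/4 + 0.4053·|t′|` suffices (`16/π² ≤ 1.6212`).
* SIZE OF THE ALLOWANCE at the «La214-E» corners (n = 1): `0.4053·(3/10) = 0.1216`, `0.4053·(1/5) = 0.0811`; with corner total-hopping words `X/4 ≈ 0.30–0.37`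
  [EST] the ray words land at `≈ 0.42–0.49` / `0.38–0.45`, i.e. AT OR ABOVE the premise-free box leaf `0.4453763` (`laBoxE_x0_stiffnessSeqLeaf`): the
  `U`-interior of the box is content-free by this route — it needs region-valid duals ((ii-b)) or per-`U` parents. The lemma is typed so that the
  verdict is a theorem-shaped statement, not a slogan.

References: R. B. Griffiths, J. Math. Phys. 7 (1966) 1215, §II [Griffiths1966]; T. Koma, H. Tasaki, J. Stat. Phys. 76 (1994) 745, §1 [KomaTasaki1994];
D. J. Scalapino, S. R. White, S.-C. Zhang, PRB 47 (1993) 7995, §II [ScalapinoWhiteZhang1993]; T. Hazra, N. Verma, M. Randeria, PRX 9 (2019) 031049,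
eqs. (2)–(4) [HazraVermaRanderia2019].
-/

noncomputable section

namespace Summit.Ventures.CertifiedManyBodySolver.Observables

open Literature.MathematicalPhysics.QuantumLattice
open Literature.MathematicalPhysics.QuantumLattice.ThermodynamicLimit
open Literature.Probability.LatticeModels
open Matrix Finset Filter Topology HubbardWave0
open scoped Matrix BigOperators ComplexOrder

/-- **The `t′ ≠ 0` U-RAY EDITION with the diagonal allowance explicit.** `0 ≤ U₀ ≤ U`, `0 ≤ n < 2`, any `t′`: if `−(k(ω) + Σ_s Re ω(Φ^{diag}_{t′})) ≤ X`
(a ceiling on minus the TOTAL `t–t′` hopping energy per site) for every torus-limit ground state of the record class at `(U₀, n, t′)`, then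
`ObsStiffnessSeqCeilingAt t′ U n c` for every `c ≥ X/4 + |t′|·min(4n, 16/π²)/4` — the total hopping transports up the ray, the diagonal remainder of
the f-sum functional is bounded by the free diagonal-lattice bar. [cite: Griffiths1966, §II] [cite: ScalapinoWhiteZhang1993, §II] -/
theorem ObsStiffnessSeqCeilingAt_on_ray_of_forall_negHoppingTT'_le (tp : ℝ) {U₀ U n : ℝ} (hU₀ : 0 ≤ U₀) (hU : U₀ ≤ U)
    (hn0 : 0 ≤ n) (hn2 : n < 2) {X : ℝ}
    (hX : ∀ (ω : InfVolFermionState 2) (Ls : ℕ → ℕ) (ψ : ∀ L, Fock (Orb (FermionTorus 2 L))),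
      Tendsto Ls atTop atTop →
      (∀ j, IsGroundStateInSector (hubbardTorusTT' (Ls j) 1 tp U₀) (rectN n (Ls j)) 0 (ψ (Ls j))) →
      (∀ j, star (ψ (Ls j)) ⬝ᵥ ψ (Ls j) = 1) → ω.IsTorusLimitOf ψ Ls →
      -((∑ i : Fin 2, -(1 : ℝ) * ∑ σ : Fin 2,
          ((ω.expect {0, 0 + unitVec i}
              ((cAt 0 (mem_insert_self _ _) σ)ᴴ * cAt (0 + unitVec i) (mem_insert_of_mem (mem_singleton_self _)) σ)).re +
            (ω.expect {0, 0 + unitVec i}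
              ((cAt (0 + unitVec i) (mem_insert_of_mem (mem_singleton_self _)) σ)ᴴ * cAt 0 (mem_insert_self _ _) σ)).re)) +
        ∑ s : Fin 2, (ω.expect {0, 0 + diagVec s} ((diagHoppingFermionInteraction tp).Φ {0, 0 + diagVec s})).re) ≤ X)
    (c : ℚ) (hc : X / 4 + |tp| * min (4 * n) (16 / Real.pi ^ 2) / 4 ≤ ((c : ℚ) : ℝ)) :
    ObsStiffnessSeqCeilingAt tp U n c := by
  intro ρs θ₀ _ hθ₀ Ls hLs hst
  refine (fluxStiffness_le_of_torusLimitTT'_oddMoment_orbit_certificate_seq tp (U := U) (δ := 1 - n)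
    (q := X / 4 + |tp| * min (4 * n) (16 / Real.pi ^ 2) / 4) 0
    Finset.univ Finset.univ_nonempty (by linarith) (by linarith) hθ₀ hLs hst ?_).trans hc
  intro ω Ms ψ hMs hψ h1 hω
  have hψ' : ∀ j, IsGroundStateInSector (hubbardTorusTT' (Ms j) 1 tp U) (rectN n (Ms j)) 0 (ψ (Ms j)) := fun j => by
    simpa only [sub_sub_cancel] using hψ j
  have hN : ∀ j, IsNParticle (rectN n (Ms j)) (ψ (Ms j)) := fun j => ((mem_szSector_iff _ _ _).1 (hψ' j).1).1
  have hTI : ω.IsTranslationInvariant := hω.isTranslationInvariant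
  rw [orbitMean_rotOddMomentLimitFunctionalTT_lam_zero_eq_meanEnergy_twice_tPrime hTI]
  -- split e_{Φ(1,2t′,0)} = e_{Φ(1,t′,0)} + e_{Φ(0,t′,0)}
  have hsplit : ω.meanEnergy (hubbardTTPrimeFermionInteraction 1 (2 * tp) 0) 1 =
      ω.meanEnergy (hubbardTTPrimeFermionInteraction 1 tp 0) 1 + ω.meanEnergy (hubbardTTPrimeFermionInteraction 0 tp 0) 1 := by
    have h := InfVolFermionState.meanEnergy_hubbardTTPrime_add (ω := ω) 1 0 tp tp 0 0
    rw [add_zero, add_zero, ← two_mul] at h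
    exact h
  -- the total hopping transports up the ray
  have hT := forall_torusLimit_negHoppingTT'_le_of_le_coupling tp hU₀ hU hn0 hn2 hX ω Ms ψ hMs hψ' h1 hω
  rw [← meanEnergy_hubbardTTPrime_oneBody_eq_hoppingDensityTT' tp hTI] at hT
  -- the diagonal remainder is bounded by the free diagonal bar
  have hd1 := hω.energyDensityTT'_le_meanEnergy_hubbardTTPrime 0 tp (U := 0) le_rfl hn0 hn2 hMs hN h1
  have hd2 := energyDensityTT'_diag_ge_min tp hn0 hn2
  rw [hsplit]
  nlinarith [hT, hd1, hd2, abs_nonneg tp]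

/-- `16/π² ≤ 1.6212`. [folklore] -/
private theorem sixteen_div_pi_sq_le_decimal : 16 / Real.pi ^ 2 ≤ 1.6212 := by
  have hπ : 3.141592 < Real.pi := Real.pi_gt_d6
  have hπ2 : (3.141592 : ℝ) ^ 2 < Real.pi ^ 2 := by nlinarith
  rw [div_le_iff₀ (by positivity)]
  nlinarith

/-- **Decimal form**: `c ≥ X/4 + 0.4053·|t′|` suffices (`min(4n, 16/π²)/4 ≤ 16/(4π²) ≤ 0.4053`). [cite: Griffiths1966, §II] [cite: ScalapinoWhiteZhang1993, §II] -/
theorem ObsStiffnessSeqCeilingAt_on_ray_of_forall_negHoppingTT'_le_decimal (tp : ℝ) {U₀ U n : ℝ} (hU₀ : 0 ≤ U₀) (hU : U₀ ≤ U)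
    (hn0 : 0 ≤ n) (hn2 : n < 2) {X : ℝ}
    (hX : ∀ (ω : InfVolFermionState 2) (Ls : ℕ → ℕ) (ψ : ∀ L, Fock (Orb (FermionTorus 2 L))),
      Tendsto Ls atTop atTop →
      (∀ j, IsGroundStateInSector (hubbardTorusTT' (Ls j) 1 tp U₀) (rectN n (Ls j)) 0 (ψ (Ls j))) →
      (∀ j, star (ψ (Ls j)) ⬝ᵥ ψ (Ls j) = 1) → ω.IsTorusLimitOf ψ Ls →
      -((∑ i : Fin 2, -(1 : ℝ) * ∑ σ : Fin 2,
          ((ω.expect {0, 0 + unitVec i}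
              ((cAt 0 (mem_insert_self _ _) σ)ᴴ * cAt (0 + unitVec i) (mem_insert_of_mem (mem_singleton_self _)) σ)).re +
            (ω.expect {0, 0 + unitVec i}
              ((cAt (0 + unitVec i) (mem_insert_of_mem (mem_singleton_self _)) σ)ᴴ * cAt 0 (mem_insert_self _ _) σ)).re)) +
        ∑ s : Fin 2, (ω.expect {0, 0 + diagVec s} ((diagHoppingFermionInteraction tp).Φ {0, 0 + diagVec s})).re) ≤ X)
    (c : ℚ) (hc : X / 4 + 0.4053 * |tp| ≤ ((c : ℚ) : ℝ)) :
    ObsStiffnessSeqCeilingAt tp U n c := by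
  refine ObsStiffnessSeqCeilingAt_on_ray_of_forall_negHoppingTT'_le tp hU₀ hU hn0 hn2 hX c (le_trans ?_ hc)
  have hmin : min (4 * n) (16 / Real.pi ^ 2) ≤ 1.6212 := (min_le_right _ _).trans sixteen_div_pi_sq_le_decimal
  nlinarith [abs_nonneg tp, hmin]

/-- **The allowance in numbers at the «La214-E» corners** (decidable): `0.4053·(3/10) = 0.12159`, `0.4053·(1/5) = 0.08106`; added to a corner word `X/4` in
`[0.30, 0.37]` the ray word exceeds `0.42` resp. `0.38`, to be compared with the premise-free box leaf `0.4453763`. [folklore] -/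
theorem tprime_ray_allowance_literals :
    ((0.4053 : ℚ) * (3 / 10) = 12159 / 100000) ∧ ((0.4053 : ℚ) * (1 / 5) = 8106 / 100000) ∧
    ((0.30 : ℚ) + 12159 / 100000 > 0.42) ∧ ((0.30 : ℚ) + 8106 / 100000 > 0.38) ∧ ((0.33 : ℚ) + 12159 / 100000 > 4453763 / 10000000) := by
  norm_num

end Summit.Ventures.CertifiedManyBodySolver.Observables
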